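import Mathlib
import HarnessLib
import Summits.HubbardSuperconductivity.HubbardSuperconductivity.Theorems.KLProgrammeKLRegimeEngineLastStepResponseInputs

/-!
# K3 gen-8-FLOW (stmt 20437, stub (C), located item #20, cure (δ′) «LAST-STEP SWAP», layer F3c′): the tangential jets of `t = (K_N ⊖ K_{n_β})∘γ/ω₀`
# with the frame curve's GRADED jet table — the n-FREE form of the `ht0`/`htd` inputs of `lastResponse_bracket`

Cell gate-hubbard-kl, seat p2 g17.  `…EngineLastStepResponseInputs` §3 asks one constant above `128·Bell(G, Dc)`; the old frame's Fermi curve has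
`‖γ‴‖ ∝ 4^m`, `‖γ⁗‖ ∝ 16^m` (`comp_graded₂_data`: `6.66·10⁹·l`, `1.04·10¹⁴·l²`), so the n-free statement takes the GRADED table `‖γ′‖, ‖γ″‖ ≤ D`,
`‖γ‴‖ ≤ D·4^m`, `‖γ⁗‖ ≤ D·16^m`, the piece constants `G j ≤ Gm` (`FlowPieceJetsAt`: `G = R.Gfr`), and ONE constant `Z ≥ 1920·Gm·D⁴`; the conclusion is
unchanged: `|t(θ)| ≤ Z·U/4^m`, `|t⁽ⁱ⁾(θ)| ≤ (Z·U/4^m)·4^{im}` (`1 ≤ i ≤ 4`, every `θ`) — every Bell monomial carries at most `4^{im}` because each spent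
derivative costs at most one `4^m` on either factor.

* §1 `tjetRowG_fin/_one/_two/_three/_four` (the four rows as polynomial inequalities in `D, l ≥ 1`);
* §2 **`lastResponse_tjets_of_pieceJets_graded`**.

Proofs only; no definitions; nothing asserts superconductivity.  Refs: BGM 2006 §2.4 (2.36)–(2.42) [cite: BenfattoGiulianiMastropietro2006].
-/

noncomputable section

namespace Summit.HubbardSuperconductivity.HubbardSuperconductivity.Theorems.EngineV8

set_option linter.dupNamespace false -- summit = problem name (single-conjunct summit), D-0017

open Real Finset Literature.MathematicalPhysics.QuantumLattice Literature.Probability.LatticeModels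
open Summit.HubbardSuperconductivity.HubbardSuperconductivity.Theorems.KLRegimeSplit
open Summit.HubbardSuperconductivity.HubbardSuperconductivity.Theorems.DispersionFlow
open Summit.HubbardSuperconductivity.HubbardSuperconductivity.Theorems.KLProgrammeLegKernels
open Summit.HubbardSuperconductivity.HubbardSuperconductivity.Theorems.PerturbedFermiCurve

variable {L M : ℕ} [NeZero L]

/-! ## §1–§2 The graded rows and the tangential jets

The rows of §3 ask one constant above `128·Bell(G, Dc)`; since the old frame's curve has `‖γ‴‖ ∝ 4^m`, `‖γ⁗‖ ∝ 16^m`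
(`comp_graded₂_data`), the n-FREE form is this one: `‖γ′‖, ‖γ″‖ ≤ D`, `‖γ‴‖ ≤ D·4^m`, `‖γ⁗‖ ≤ D·16^m`, all piece constants `G j ≤ Gm`, and
`Z ≥ 1920·Gm·D⁴` give the same conclusion `|t| ≤ ZU/4^m`, `|t⁽ⁱ⁾| ≤ (ZU/4^m)·4^{im}`. -/

section RowsGraded

variable {l li U Z Gm D : ℝ} (hli1 : li * l ^ 2 = 1) (hl1 : 1 ≤ l) (hU0 : 0 < U) (hU1 : U ≤ 1) (hGm : 0 ≤ Gm) (hD : 1 ≤ D)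
  (hZ : 1920 * Gm * D ^ 4 ≤ Z)
include hli1 hl1 hU0 hU1 hGm hD hZ

omit hli1 in
/-- The closing step of every row: `c ≤ 15` ⇒ `128·(c·Gm·D⁴·U²·lⁿ) ≤ Z·U·lⁿ`. -/
theorem tjetRowG_fin {c : ℝ} (n : ℕ) (hc : c ≤ 15) : 128 * (c * Gm * D ^ 4 * U ^ 2 * l ^ n) ≤ Z * U * l ^ n := by
  have hU2 : U ^ 2 ≤ U := by nlinarith
  have hl0 : 0 ≤ l := by linarith
  have h1 : 128 * (c * Gm * D ^ 4) ≤ Z := by nlinarith [mul_nonneg hGm (by positivity : (0 : ℝ) ≤ D ^ 4)]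
  have hZ0 : 0 ≤ Z := le_trans (by positivity) hZ
  calc 128 * (c * Gm * D ^ 4 * U ^ 2 * l ^ n) = (128 * (c * Gm * D ^ 4)) * (U ^ 2 * l ^ n) := by ring
    _ ≤ Z * (U ^ 2 * l ^ n) := mul_le_mul_of_nonneg_right h1 (by positivity)
    _ ≤ Z * (U * l ^ n) := mul_le_mul_of_nonneg_left (mul_le_mul_of_nonneg_right hU2 (by positivity)) hZ0
    _ = Z * U * l ^ n := by ring

/-- Row `i = 1`: Bell row `M 1·D` with `M j = Gm·U²·lʲ·l⁻²`, curve table `(D, D, D·l, D·l²)`. -/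
theorem tjetRowG_one : 128 * (Gm * U ^ 2 * l ^ 1 * li * D) * l ^ 2 ≤ Z * U * l ^ 1 := by
  have e : 128 * (Gm * U ^ 2 * l ^ 1 * li * D) * l ^ 2 = 128 * (D * Gm * U ^ 2 * l ^ 1) := by
    linear_combination (128 * (D * Gm * U ^ 2 * l ^ 1)) * hli1
  rw [e]
  have hD4 : D ≤ D ^ 4 := by nlinarith [one_le_pow₀ (n := 3) hD]
  calc 128 * (D * Gm * U ^ 2 * l ^ 1) ≤ 128 * (1 * Gm * D ^ 4 * U ^ 2 * l ^ 1) := by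
        have : D * Gm ≤ 1 * Gm * D ^ 4 := by nlinarith [mul_le_mul_of_nonneg_left hD4 hGm]
        have h0 : 0 ≤ U ^ 2 * l ^ 1 := by positivity
        nlinarith [mul_le_mul_of_nonneg_right this h0]
    _ ≤ Z * U * l ^ 1 := tjetRowG_fin hl1 hU0 hU1 hGm hD hZ 1 (by norm_num)

/-- Row `i = 2`. -/
theorem tjetRowG_two : 128 * (Gm * U ^ 2 * l ^ 2 * li * D ^ 2 + Gm * U ^ 2 * l ^ 1 * li * D) * l ^ 2 ≤ Z * U * l ^ 2 := by
  have e : 128 * (Gm * U ^ 2 * l ^ 2 * li * D ^ 2 + Gm * U ^ 2 * l ^ 1 * li * D) * l ^ 2 = 128 * ((D ^ 2 * l ^ 2 + D * l) * Gm * U ^ 2) := by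
    linear_combination (128 * ((D ^ 2 * l ^ 2 + D * l) * Gm * U ^ 2)) * hli1
  rw [e]
  have hbr : D ^ 2 * l ^ 2 + D * l ≤ 2 * D ^ 4 * l ^ 2 := by
    have a : D ^ 2 ≤ D ^ 4 := pow_le_pow_right₀ hD (by norm_num)
    have b : D ≤ D ^ 4 := by nlinarith [one_le_pow₀ (n := 3) hD]
    have c : l ≤ l ^ 2 := by nlinarith
    nlinarith [mul_le_mul a (le_refl (l ^ 2)) (by positivity) (by positivity), mul_le_mul b c (by positivity) (by positivity)]
  calc 128 * ((D ^ 2 * l ^ 2 + D * l) * Gm * U ^ 2) ≤ 128 * (2 * Gm * D ^ 4 * U ^ 2 * l ^ 2) := by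
        nlinarith [mul_le_mul_of_nonneg_right hbr (by positivity : 0 ≤ Gm * U ^ 2)]
    _ ≤ Z * U * l ^ 2 := tjetRowG_fin hl1 hU0 hU1 hGm hD hZ 2 (by norm_num)

/-- Row `i = 3`. -/
theorem tjetRowG_three : 128 * (Gm * U ^ 2 * l ^ 3 * li * D ^ 3 + 3 * (Gm * U ^ 2 * l ^ 2 * li) * D * D + Gm * U ^ 2 * l ^ 1 * li * (D * l)) * l ^ 2 ≤
    Z * U * l ^ 3 := by
  have e : 128 * (Gm * U ^ 2 * l ^ 3 * li * D ^ 3 + 3 * (Gm * U ^ 2 * l ^ 2 * li) * D * D + Gm * U ^ 2 * l ^ 1 * li * (D * l)) * l ^ 2 =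
      128 * ((D ^ 3 * l ^ 3 + 3 * D ^ 2 * l ^ 2 + D * l ^ 2) * Gm * U ^ 2) := by
    linear_combination (128 * ((D ^ 3 * l ^ 3 + 3 * D ^ 2 * l ^ 2 + D * l ^ 2) * Gm * U ^ 2)) * hli1
  rw [e]
  have hbr : D ^ 3 * l ^ 3 + 3 * D ^ 2 * l ^ 2 + D * l ^ 2 ≤ 5 * D ^ 4 * l ^ 3 := by
    have a : D ^ 3 ≤ D ^ 4 := pow_le_pow_right₀ hD (by norm_num)
    have b : D ^ 2 ≤ D ^ 4 := pow_le_pow_right₀ hD (by norm_num)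
    have b' : D ≤ D ^ 4 := by nlinarith [one_le_pow₀ (n := 3) hD]
    have c : l ^ 2 ≤ l ^ 3 := pow_le_pow_right₀ hl1 (by norm_num)
    nlinarith [mul_le_mul a (le_refl (l ^ 3)) (by positivity) (by positivity), mul_le_mul b c (by positivity) (by positivity),
      mul_le_mul b' c (by positivity) (by positivity)]
  calc 128 * ((D ^ 3 * l ^ 3 + 3 * D ^ 2 * l ^ 2 + D * l ^ 2) * Gm * U ^ 2) ≤ 128 * (5 * Gm * D ^ 4 * U ^ 2 * l ^ 3) := by
        nlinarith [mul_le_mul_of_nonneg_right hbr (by positivity : 0 ≤ Gm * U ^ 2)]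
    _ ≤ Z * U * l ^ 3 := tjetRowG_fin hl1 hU0 hU1 hGm hD hZ 3 (by norm_num)

/-- Row `i = 4`. -/
theorem tjetRowG_four : 128 * (Gm * U ^ 2 * l ^ 4 * li * D ^ 4 + 6 * (Gm * U ^ 2 * l ^ 3 * li) * D ^ 2 * D + 3 * (Gm * U ^ 2 * l ^ 2 * li) * D ^ 2 +
      4 * (Gm * U ^ 2 * l ^ 2 * li) * D * (D * l) + Gm * U ^ 2 * l ^ 1 * li * (D * l ^ 2)) * l ^ 2 ≤ Z * U * l ^ 4 := by
  have e : 128 * (Gm * U ^ 2 * l ^ 4 * li * D ^ 4 + 6 * (Gm * U ^ 2 * l ^ 3 * li) * D ^ 2 * D + 3 * (Gm * U ^ 2 * l ^ 2 * li) * D ^ 2 +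
        4 * (Gm * U ^ 2 * l ^ 2 * li) * D * (D * l) + Gm * U ^ 2 * l ^ 1 * li * (D * l ^ 2)) * l ^ 2 =
      128 * ((D ^ 4 * l ^ 4 + 6 * D ^ 3 * l ^ 3 + 3 * D ^ 2 * l ^ 2 + 4 * D ^ 2 * l ^ 3 + D * l ^ 3) * Gm * U ^ 2) := by
    linear_combination (128 * ((D ^ 4 * l ^ 4 + 6 * D ^ 3 * l ^ 3 + 3 * D ^ 2 * l ^ 2 + 4 * D ^ 2 * l ^ 3 + D * l ^ 3) * Gm * U ^ 2)) * hli1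
  rw [e]
  have hbr : D ^ 4 * l ^ 4 + 6 * D ^ 3 * l ^ 3 + 3 * D ^ 2 * l ^ 2 + 4 * D ^ 2 * l ^ 3 + D * l ^ 3 ≤ 15 * D ^ 4 * l ^ 4 := by
    have a : D ^ 3 ≤ D ^ 4 := pow_le_pow_right₀ hD (by norm_num)
    have b : D ^ 2 ≤ D ^ 4 := pow_le_pow_right₀ hD (by norm_num)
    have b' : D ≤ D ^ 4 := by nlinarith [one_le_pow₀ (n := 3) hD]
    have c : l ^ 3 ≤ l ^ 4 := pow_le_pow_right₀ hl1 (by norm_num)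
    have c' : l ^ 2 ≤ l ^ 4 := pow_le_pow_right₀ hl1 (by norm_num)
    nlinarith [mul_le_mul a c (by positivity) (by positivity), mul_le_mul b c' (by positivity) (by positivity),
      mul_le_mul b c (by positivity) (by positivity), mul_le_mul b' c (by positivity) (by positivity)]
  calc 128 * ((D ^ 4 * l ^ 4 + 6 * D ^ 3 * l ^ 3 + 3 * D ^ 2 * l ^ 2 + 4 * D ^ 2 * l ^ 3 + D * l ^ 3) * Gm * U ^ 2)
      ≤ 128 * (15 * Gm * D ^ 4 * U ^ 2 * l ^ 4) := by
        nlinarith [mul_le_mul_of_nonneg_right hbr (by positivity : 0 ≤ Gm * U ^ 2)]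
    _ ≤ Z * U * l ^ 4 := tjetRowG_fin hl1 hU0 hU1 hGm hD hZ 4 (by norm_num)

end RowsGraded

section TJetsGraded

variable {β : ℝ} (hβ : 0 < β) {m : ℕ} (hN : nScales β < m + 1) {U : ℝ} (hU0 : 0 < U) (hU1 : U ≤ 1) (Ko P : TrigPolyC4v)
  {G : ℕ → ℝ} {Gm : ℝ} (hG0 : ∀ j ≤ 4, 0 ≤ G j) (hGm : ∀ j ≤ 4, G j ≤ Gm)
  (hPJ : ∀ j ≤ 4, ∀ q : Momentum, ‖iteratedFDeriv ℝ j (evalM P) q‖ ≤ G j * uPow j U * (4 : ℝ) ^ (((j : ℤ) - 2) * m))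
  {γ : ℝ → Momentum} (hγ : ContDiff ℝ 4 γ) {Dc : ℕ → ℝ} (hDc : ∀ θ : ℝ, ∀ i, 1 ≤ i → i ≤ 4 → ‖iteratedDeriv i γ θ‖ ≤ Dc i)
  {D : ℝ} (hD : 1 ≤ D) (hDc1 : Dc 1 ≤ D) (hDc2 : Dc 2 ≤ D) (hDc3 : Dc 3 ≤ D * (4 : ℝ) ^ m) (hDc4 : Dc 4 ≤ D * ((4 : ℝ) ^ m) ^ 2)
include hβ hN hU0 hU1 hG0 hGm hPJ hγ hDc hD hDc1 hDc2 hDc3 hDc4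

/-- **THE TANGENTIAL JETS OF `t`.**  With the piece's sup-jets `‖Dʲ evalM P‖ ≤ G j·uPow j U·4^{(j−2)m} ≤ Gm·…` and a GRADED curve table
`‖γ′‖, ‖γ″‖ ≤ D`, `‖γ‴‖ ≤ D·4^m`, `‖γ⁗‖ ≤ D·16^m` (the frame curve's own `4^{(i−2)m}` law, `comp_graded₂_data`), and `Z ≥ 1920·Gm·D⁴`:
`|t(θ)| ≤ Z·U/4^m` and `|t⁽ⁱ⁾(θ)| ≤ (Z·U/4^m)·(4^m)ⁱ` for `1 ≤ i ≤ 4`, every `θ` (`t = evalM ((Ko ⊖ P) ⊖ Ko)∘γ/(π/β) = −evalM P∘γ/ω₀`). -/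
theorem lastResponse_tjets_of_pieceJets_graded {Z : ℝ} (hZ : 1920 * Gm * D ^ 4 ≤ Z) :
    (∀ θ : ℝ, |(fun θ' : ℝ => evalM (fsub (fsub Ko P) Ko) (γ θ') / (Real.pi / β)) θ| ≤ Z * U / (4 : ℝ) ^ m) ∧
    (∀ θ : ℝ, ∀ i, 1 ≤ i → i ≤ 4 →
      |iteratedDeriv i (fun θ' : ℝ => evalM (fsub (fsub Ko P) Ko) (γ θ') / (Real.pi / β)) θ| ≤ (Z * U / (4 : ℝ) ^ m) * ((4 : ℝ) ^ m) ^ i) := by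
  have hπ := Real.pi_pos
  set l : ℝ := (4 : ℝ) ^ m with hl
  have hl1 : 1 ≤ l := one_le_pow₀ (by norm_num)
  have hl0 : 0 < l := by positivity
  have hGm0 : 0 ≤ Gm := (hG0 0 (by norm_num)).trans (hGm 0 (by norm_num))
  have hD0 : 0 ≤ D := zero_le_one.trans hD
  have hZ0 : 0 ≤ Z := le_trans (by positivity) hZ
  -- the price of `1/ω₀`: `β/π ≤ 32·4^{m+1} = 128·l`
  have hinv : β / Real.pi ≤ 128 * l := by
    have := beta_div_pi_le_of_nScales_lt hβ hN; rw [pow_succ] at this; linarith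
  -- `t = −(β/π)·(evalM P ∘ γ)`
  have ht : (fun θ' : ℝ => evalM (fsub (fsub Ko P) Ko) (γ θ') / (Real.pi / β)) = fun θ' => (-(β / Real.pi)) * (evalM P ∘ γ) θ' := by
    funext θ'; simp only [Function.comp_apply, evalM_fsub]; field_simp; ring
  have hF : ContDiff ℝ 4 (evalM P) := contDiff_evalM P
  have hcomp : ContDiff ℝ 4 (evalM P ∘ γ) := hF.comp hγ
  have hzl : ∀ j : ℕ, (4 : ℝ) ^ (((j : ℤ) - 2) * m) = l ^ j / l ^ 2 := fun j => by
    rw [eq_div_iff (by positivity), hl]; exact four_zpow_sub_two_mul_mul_sq j m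
  refine ⟨fun θ => ?_, fun θ i hi1 hi4 => ?_⟩
  · -- value: `|t| ≤ (β/π)·G 0·|U|/l² ≤ 128·Gm·U/l ≤ Z·U/l`
    rw [ht]
    simp only [Function.comp_apply, abs_mul, abs_neg, abs_of_pos (div_pos hβ hπ)]
    have h0 := hPJ 0 (by norm_num) (γ θ)
    rw [hzl 0, norm_iteratedFDeriv_zero, Real.norm_eq_abs, pow_zero, uPow_zero, abs_of_pos hU0] at h0
    have hG0m : G 0 ≤ Gm := hGm 0 (by norm_num)
    have hZ' : 128 * Gm ≤ Z := by
      have : Gm ≤ Gm * D ^ 4 := by nlinarith [one_le_pow₀ (n := 4) hD]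
      linarith
    calc β / Real.pi * |evalM P (γ θ)| ≤ (128 * l) * (G 0 * U * (1 / l ^ 2)) :=
          mul_le_mul hinv h0 (abs_nonneg _) (by positivity)
      _ = (128 * G 0) * U / l := by field_simp
      _ ≤ (128 * Gm) * U / l := by gcongr
      _ ≤ Z * U / l := by gcongr
  · -- derivatives: Bell with the BOUND tables `M j := Gm·U²·lʲ·l⁻²`, `(D, D, D·l, D·l²)`
    have hk' : ((i : ℕ) : WithTop ℕ∞) ≤ 4 := by exact_mod_cast hi4
    rw [ht, iteratedDeriv_const_mul _ (hcomp.contDiffAt.of_le hk'), abs_mul, abs_neg, abs_of_pos (div_pos hβ hπ)]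
    set li : ℝ := (l ^ 2)⁻¹ with hli
    have hli1 : li * l ^ 2 = 1 := inv_mul_cancel₀ (by positivity)
    have hli0 : 0 < li := by positivity
    have hM : ∀ j, 1 ≤ j → j ≤ 4 → ‖iteratedFDeriv ℝ j (evalM P) (γ θ)‖ ≤ Gm * U ^ 2 * l ^ j * li := by
      intro j hj1 hj4
      have h := hPJ j hj4 (γ θ)
      have hu : uPow j U = U ^ 2 := by unfold uPow; rw [if_neg (by omega)]
      rw [hzl j, hu, div_eq_mul_inv, ← mul_assoc] at h
      exact h.trans (by gcongr; exact hGm j hj4)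
    have hDc' : ∀ i, 1 ≤ i → i ≤ 4 → ‖iteratedDeriv i γ θ‖ ≤ (fun i => if i = 3 then D * l else if i = 4 then D * l ^ 2 else D) i := by
      intro i hi1 hi4
      interval_cases i
      · exact (hDc θ 1 le_rfl (by norm_num)).trans hDc1
      · exact (hDc θ 2 (by norm_num) (by norm_num)).trans hDc2
      · exact (hDc θ 3 (by norm_num) (by norm_num)).trans hDc3
      · exact (hDc θ 4 (by norm_num) le_rfl).trans hDc4
    obtain ⟨hb1, hb2, hb3, hb4⟩ := abs_iteratedDeriv_comp_le_bell (F := evalM P) hF hγ (M := fun j => Gm * U ^ 2 * l ^ j * li)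
      (D := fun i => if i = 3 then D * l else if i = 4 then D * l ^ 2 else D) hM hDc'
    simp only [show (1 : ℕ) ≠ 3 by norm_num, show (1 : ℕ) ≠ 4 by norm_num, show (2 : ℕ) ≠ 3 by norm_num, show (2 : ℕ) ≠ 4 by norm_num,
      show (4 : ℕ) ≠ 3 by norm_num, if_true, if_false] at hb1 hb2 hb3 hb4
    -- `(β/π)·|X| ≤ (Z U/l)·lⁱ` from `|X| ≤ B` and `128·B·l² ≤ Z·U·lⁱ`
    have goal_of : ∀ {X B : ℝ}, |X| ≤ B → 128 * B * l ^ 2 ≤ Z * U * l ^ i → β / Real.pi * |X| ≤ Z * U / l * l ^ i := by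
      intro X B hX hB
      calc β / Real.pi * |X| ≤ (128 * l) * B := mul_le_mul hinv hX (abs_nonneg _) (by positivity)
        _ = (128 * B * l ^ 2) / l := by rw [eq_div_iff hl0.ne']; ring
        _ ≤ (Z * U * l ^ i) / l := div_le_div_of_nonneg_right hB hl0.le
        _ = Z * U / l * l ^ i := by ring
    interval_cases i
    · exact goal_of hb1 (tjetRowG_one hli1 hl1 hU0 hU1 hGm0 hD hZ)
    · exact goal_of hb2 (tjetRowG_two hli1 hl1 hU0 hU1 hGm0 hD hZ)
    · exact goal_of hb3 (tjetRowG_three hli1 hl1 hU0 hU1 hGm0 hD hZ)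
    · exact goal_of hb4 (tjetRowG_four hli1 hl1 hU0 hU1 hGm0 hD hZ)

end TJetsGraded

end Summit.HubbardSuperconductivity.HubbardSuperconductivity.Theorems.EngineV8

end
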